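import Mathlib
import Summits.ResolutionOfSingularities.ResolutionOfSingularities.Theorems.WildQuotientsWildQuotientResolutionToricExitWeightZero

/-!
# R-T rung, `J₅`, `μ₄`-vertex: the cone `¼(1,1,2,3)` — its thirteen monomials generate the weight-`0` part

(crux stmt-ResolutionOfSingularities-15640 `WildQuotients.WildQuotientResolution`, line `Sketch`,
sector `|G| = p`; RUNG V5 of `L/w45c/CHAIN.md` v8 §5/(III), supply for brick HP₀ of
res-L1-w45c-lead-1's `stubs/J5Bricks.lean` (2026-08-27T10:32:12Z: «036 SliceX0 feeds HP₀») between
res-type-036's B2 (`ToricExit.rootChart5_fixedPoints_eq` p523699, `JordanFive.chart0_fixedPoints_eq_map`)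
and res-L1-w45c-stub-4's `μ₄`-piece exit (cone `¼(1,1,2,3)`, FINDING 2026-08-27T10:31:56Z: Hilbert
basis `s⁴, s³t, s²t², st³, t⁴, s²u, stu, t²u, u², sv, tv, uv², v⁴` on weights `(1,1,2,3)`);
the `J₅` twin of `Third112WeightZero` (B0-a, res-type-035 p502264), in «any subalgebra» form so that
it does not depend on the presentation stub-4 will define. [OURS · L1 W4.5c] — NOT a statement of any
manuscript; replaces the role of no printed item. Prover res-type-036. Def-free: the `μ₄`-weight is a
parameter `w : Fin n → ZMod 4` with `w a = 1, w b = 1, w c = 2, w d = 3`, `w = 0` elsewhere.)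

* `pow_mul_pow_mem_of_four_dvd`, `pow_mul_pow_mul_pow_mem_of_four_dvd`,
  `prod_pow_mem_of_four_dvd` — SEMIGROUP GENERATION: a monomial `s^i t^j u^l v^m` (`s = X a`,
  `t = X b`, `u = X c`, `v = X d`) with `4 ∣ i + j + 2l + 3m` lies in every subalgebra containing the
  thirteen cone monomials (strip `v` by `sv`, `tv`, `uv²`, `v⁴`; strip `u` by `s²u`, `stu`, `t²u`,
  `u²`; finish on the `(s,t)`-Veronese `s⁴, s³t, s²t², st³, t⁴`);
* `monomial_mem_of_four_dvd` — the same for a full monomial `x^e` (passengers `X i`, `i ∉ {a,b,c,d}`,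
  in the subalgebra), via the exponent bookkeeping `eq_singles_add_filter`;
* `weight_eq_natCast` — `Finsupp.weight w e = ↑(e a + e b + 2 e c + 3 e d)` in `ZMod 4`;
* `mem_adjoin_iff_isWeightedHomogeneous_zero` — **for any set `G` of weight-`0` elements whose
  generated subalgebra contains the thirteen monomials and the passengers,
  `f ∈ Algebra.adjoin R G ↔ IsWeightedHomogeneous w f 0`** (by res-L1-w45c-stub-1's generic
  `ToricExit.mem_adjoin_iff_isWeightedHomogeneous_zero`, p490929).
Both residues `p̄ = p mod 4 ∈ {1, 3}` of the `J₅` `μ₄`-vertex use THIS cone (`(1,3,2,3) = 3·(3,1,2,1)`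
in `ZMod 4`: exchange the roles of `a` and `b`'s partners; `JordanFour.isWeightedHomogeneous_zero_iff_of_mul`).
-/

-- single-problem summit: the doubled namespace component `ResolutionOfSingularities` is forced
set_option linter.dupNamespace false

noncomputable section

open MvPolynomial

namespace Summit.ResolutionOfSingularities.ResolutionOfSingularities.Theorems.WildQuotientResolution.Quarter1123

section AnySubalgebra

variable {R : Type*} [CommRing R] {n : ℕ} {A : Subalgebra R (MvPolynomial (Fin n) R)}
  {a b c d : Fin n}
  (h40 : (X a ^ 4 : MvPolynomial (Fin n) R) ∈ A) (h31 : (X a ^ 3 * X b : MvPolynomial (Fin n) R) ∈ A)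
  (h22 : (X a ^ 2 * X b ^ 2 : MvPolynomial (Fin n) R) ∈ A)
  (h13 : (X a * X b ^ 3 : MvPolynomial (Fin n) R) ∈ A) (h04 : (X b ^ 4 : MvPolynomial (Fin n) R) ∈ A)
  (h201 : (X a ^ 2 * X c : MvPolynomial (Fin n) R) ∈ A)
  (h111 : (X a * X b * X c : MvPolynomial (Fin n) R) ∈ A)
  (h021 : (X b ^ 2 * X c : MvPolynomial (Fin n) R) ∈ A) (h002 : (X c ^ 2 : MvPolynomial (Fin n) R) ∈ A)
  (h1001 : (X a * X d : MvPolynomial (Fin n) R) ∈ A) (h0101 : (X b * X d : MvPolynomial (Fin n) R) ∈ A)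
  (h0012 : (X c * X d ^ 2 : MvPolynomial (Fin n) R) ∈ A) (h0004 : (X d ^ 4 : MvPolynomial (Fin n) R) ∈ A)

include h40 h31 h22 h13 h04 in
/-- The `(s,t)`-face: `4 ∣ i + j ⇒ s^i t^j ∈ A` for any subalgebra `A` containing the Veronese
monomials `s⁴, s³t, s²t², st³, t⁴` (write `i = 4q + r`, `j = 4q' + r'`; the residue pairs with
`4 ∣ r + r'` are `(0,0), (1,3), (2,2), (3,1)`). [OURS · W4.5c] [folklore] -/
theorem pow_mul_pow_mem_of_four_dvd (i j : ℕ) (h : 4 ∣ i + j) :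
    (X a ^ i * X b ^ j : MvPolynomial (Fin n) R) ∈ A := by
  obtain ⟨q, r, hr, rfl⟩ : ∃ q r, r < 4 ∧ i = 4 * q + r :=
    ⟨i / 4, i % 4, Nat.mod_lt _ (by norm_num), (Nat.div_add_mod i 4).symm⟩
  obtain ⟨q', r', hr', rfl⟩ : ∃ q' r', r' < 4 ∧ j = 4 * q' + r' :=
    ⟨j / 4, j % 4, Nat.mod_lt _ (by norm_num), (Nat.div_add_mod j 4).symm⟩
  have e : (X a ^ (4 * q + r) * X b ^ (4 * q' + r') : MvPolynomial (Fin n) R) =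
      (X a ^ 4) ^ q * (X b ^ 4) ^ q' * (X a ^ r * X b ^ r') := by
    rw [pow_add, pow_add, pow_mul, pow_mul]; ring
  rw [e]
  refine A.mul_mem (A.mul_mem (A.pow_mem h40 q) (A.pow_mem h04 q')) ?_
  have hrr : 4 ∣ r + r' := by omega
  interval_cases r
  · obtain rfl : r' = 0 := by omega
    rw [pow_zero, pow_zero, mul_one]
    exact A.one_mem
  · obtain rfl : r' = 3 := by omega
    rw [pow_one]
    exact h13
  · obtain rfl : r' = 2 := by omega
    exact h22
  · obtain rfl : r' = 1 := by omega
    rw [pow_one]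
    exact h31

include h40 h31 h22 h13 h04 h201 h111 h021 h002 in
/-- Adding `u` (weight `2`): `4 ∣ i + j + 2l ⇒ s^i t^j u^l ∈ A` when moreover `s²u, stu, t²u, u² ∈ A`
(write `l = 2q + r`; for `r = 1` absorb the last `u` by `s²u` / `stu` / `t²u` according to
`i ≥ 2` / `i = 1` / `i = 0`). [OURS · W4.5c] [folklore] -/
theorem pow_mul_pow_mul_pow_mem_of_four_dvd (i j l : ℕ) (h : 4 ∣ i + j + 2 * l) :
    (X a ^ i * X b ^ j * X c ^ l : MvPolynomial (Fin n) R) ∈ A := by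
  obtain ⟨q, r, hr, rfl⟩ : ∃ q r, r < 2 ∧ l = 2 * q + r :=
    ⟨l / 2, l % 2, Nat.mod_lt _ (by norm_num), (Nat.div_add_mod l 2).symm⟩
  interval_cases r
  · -- `l` even
    have e : (X a ^ i * X b ^ j * X c ^ (2 * q + 0) : MvPolynomial (Fin n) R) =
        (X c ^ 2) ^ q * (X a ^ i * X b ^ j) := by
      rw [add_zero, pow_mul]; ring
    rw [e]
    exact A.mul_mem (A.pow_mem h002 q) (pow_mul_pow_mem_of_four_dvd h40 h31 h22 h13 h04 i j (by omega))
  · -- `l` odd: one `u` to absorb, `i + j ≡ 2 (mod 4)`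
    have e : (X a ^ i * X b ^ j * X c ^ (2 * q + 1) : MvPolynomial (Fin n) R) =
        (X c ^ 2) ^ q * (X a ^ i * X b ^ j * X c) := by
      rw [pow_add, pow_one, pow_mul]; ring
    rw [e]
    refine A.mul_mem (A.pow_mem h002 q) ?_
    rcases Nat.lt_or_ge i 2 with hlt | hge
    · interval_cases i
      · obtain ⟨j', rfl⟩ : ∃ j', j = j' + 2 := ⟨j - 2, by omega⟩
        have e' : (X a ^ 0 * X b ^ (j' + 2) * X c : MvPolynomial (Fin n) R) =
            (X b ^ 2 * X c) * (X a ^ 0 * X b ^ j') := by ring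
        rw [e']
        exact A.mul_mem h021 (pow_mul_pow_mem_of_four_dvd h40 h31 h22 h13 h04 0 j' (by omega))
      · obtain ⟨j', rfl⟩ : ∃ j', j = j' + 1 := ⟨j - 1, by omega⟩
        have e' : (X a ^ 1 * X b ^ (j' + 1) * X c : MvPolynomial (Fin n) R) =
            (X a * X b * X c) * (X a ^ 0 * X b ^ j') := by ring
        rw [e']
        exact A.mul_mem h111 (pow_mul_pow_mem_of_four_dvd h40 h31 h22 h13 h04 0 j' (by omega))
    · obtain ⟨i', rfl⟩ : ∃ i', i = i' + 2 := ⟨i - 2, by omega⟩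
      have e' : (X a ^ (i' + 2) * X b ^ j * X c : MvPolynomial (Fin n) R) =
          (X a ^ 2 * X c) * (X a ^ i' * X b ^ j) := by ring
      rw [e']
      exact A.mul_mem h201 (pow_mul_pow_mem_of_four_dvd h40 h31 h22 h13 h04 i' j (by omega))

include h40 h31 h22 h13 h04 h201 h111 h021 h002 h1001 h0101 h0012 h0004 in
/-- **Semigroup generation for `¼(1,1,2,3)`**: `4 ∣ i + j + 2l + 3m ⇒ s^i t^j u^l v^m ∈ A` for any
subalgebra `A` containing the thirteen monomials `s⁴, s³t, s²t², st³, t⁴, s²u, stu, t²u, u², sv, tv,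
uv², v⁴` (strip `v`: by `v⁴` while `m ≥ 4`, else by `sv` / `tv` while `i` / `j` is positive, and in
the residual case `i = j = 0` necessarily `m = 2` with `l` odd, absorbed by `uv²`). [OURS · W4.5c] -/
theorem prod_pow_mem_of_four_dvd (m : ℕ) : ∀ i j l : ℕ, 4 ∣ i + j + 2 * l + 3 * m →
    (X a ^ i * X b ^ j * X c ^ l * X d ^ m : MvPolynomial (Fin n) R) ∈ A := by
  induction m using Nat.strong_induction_on with
  | _ m ih =>
  intro i j l hdiv
  rcases Nat.lt_or_ge m 4 with hlt | hge
  · rcases Nat.eq_zero_or_pos m with rfl | hpos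
    · rw [pow_zero, mul_one]
      exact pow_mul_pow_mul_pow_mem_of_four_dvd h40 h31 h22 h13 h04 h201 h111 h021 h002 i j l
        (by omega)
    · obtain ⟨m', rfl⟩ : ∃ m', m = m' + 1 := ⟨m - 1, by omega⟩
      rcases Nat.eq_zero_or_pos i with rfl | hi
      · rcases Nat.eq_zero_or_pos j with rfl | hj
        · -- `i = j = 0`: then `m = 2` and `l` is odd
          have hm : m' = 1 := by omega
          subst hm
          obtain ⟨l', rfl⟩ : ∃ l', l = l' + 1 := ⟨l - 1, by omega⟩
          have h0 := ih 0 (by omega) 0 0 l' (by omega)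
          have e : (X a ^ 0 * X b ^ 0 * X c ^ (l' + 1) * X d ^ (1 + 1) : MvPolynomial (Fin n) R) =
              (X c * X d ^ 2) * (X a ^ 0 * X b ^ 0 * X c ^ l' * X d ^ 0) := by ring
          rw [e]
          exact A.mul_mem h0012 h0
        · obtain ⟨j', rfl⟩ : ∃ j', j = j' + 1 := ⟨j - 1, by omega⟩
          have h0 := ih m' (by omega) 0 j' l (by omega)
          have e : (X a ^ 0 * X b ^ (j' + 1) * X c ^ l * X d ^ (m' + 1) : MvPolynomial (Fin n) R) =
              (X b * X d) * (X a ^ 0 * X b ^ j' * X c ^ l * X d ^ m') := by ring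
          rw [e]
          exact A.mul_mem h0101 h0
      · obtain ⟨i', rfl⟩ : ∃ i', i = i' + 1 := ⟨i - 1, by omega⟩
        have h0 := ih m' (by omega) i' j l (by omega)
        have e : (X a ^ (i' + 1) * X b ^ j * X c ^ l * X d ^ (m' + 1) : MvPolynomial (Fin n) R) =
            (X a * X d) * (X a ^ i' * X b ^ j * X c ^ l * X d ^ m') := by ring
        rw [e]
        exact A.mul_mem h1001 h0
  · obtain ⟨m', rfl⟩ : ∃ m', m = m' + 4 := ⟨m - 4, by omega⟩
    have h0 := ih m' (by omega) i j l (by omega)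
    have e : (X a ^ i * X b ^ j * X c ^ l * X d ^ (m' + 4) : MvPolynomial (Fin n) R) =
        X d ^ 4 * (X a ^ i * X b ^ j * X c ^ l * X d ^ m') := by ring
    rw [e]
    exact A.mul_mem h0004 h0

/-- Exponent bookkeeping: `e = single a (e a) + single b (e b) + single c (e c) + single d (e d)
+ e|_{passengers}` for pairwise distinct `a, b, c, d`. [folklore] -/
theorem eq_singles_add_filter (hab : a ≠ b) (hac : a ≠ c) (had : a ≠ d) (hbc : b ≠ c) (hbd : b ≠ d)
    (hcd : c ≠ d) (e : Fin n →₀ ℕ) :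
    e = Finsupp.single a (e a) + Finsupp.single b (e b) + Finsupp.single c (e c)
      + Finsupp.single d (e d) + e.filter (fun i => i ≠ a ∧ i ≠ b ∧ i ≠ c ∧ i ≠ d) := by
  classical
  ext i
  simp only [Finsupp.coe_add, Pi.add_apply, Finsupp.single_apply, Finsupp.filter_apply]
  have hba : b ≠ a := hab.symm
  have hca : c ≠ a := hac.symm
  have hda : d ≠ a := had.symm
  have hcb : c ≠ b := hbc.symm
  have hdb : d ≠ b := hbd.symm
  have hdc : d ≠ c := hcd.symm
  by_cases hia : i = a
  · rw [hia]; simp [hba, hca, hda]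
  · by_cases hib : i = b
    · rw [hib]; simp [hab, hcb, hdb]
    · by_cases hic : i = c
      · rw [hic]; simp [hac, hbc, hdc]
      · by_cases hid : i = d
        · rw [hid]; simp [had, hbd, hcd]
        · simp [hia, hib, hic, hid, Ne.symm hia, Ne.symm hib, Ne.symm hic, Ne.symm hid]

/-- Monomial splitting along the bookkeeping identity:
`x^e = s^{e a} t^{e b} u^{e c} v^{e d} · x^{e|passengers}`. [folklore] -/
theorem monomial_eq_abcd_mul_passengers (hab : a ≠ b) (hac : a ≠ c) (had : a ≠ d) (hbc : b ≠ c)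
    (hbd : b ≠ d) (hcd : c ≠ d) (e : Fin n →₀ ℕ) :
    (monomial e (1 : R) : MvPolynomial (Fin n) R)
      = X a ^ e a * X b ^ e b * X c ^ e c * X d ^ e d *
        monomial (e.filter fun i => i ≠ a ∧ i ≠ b ∧ i ≠ c ∧ i ≠ d) 1 := by
  have he := eq_singles_add_filter hab hac had hbc hbd hcd e
  conv_rhs => rw [X_pow_eq_monomial, X_pow_eq_monomial, X_pow_eq_monomial, X_pow_eq_monomial,
    monomial_mul, monomial_mul, monomial_mul, monomial_mul, mul_one, mul_one, mul_one, mul_one]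
  rw [← he]

/-- Passenger monomials lie in any subalgebra containing the passenger variables. [folklore] -/
theorem monomial_passengers_mem (hpass : ∀ i, i ≠ a → i ≠ b → i ≠ c → i ≠ d → X i ∈ A)
    (e : Fin n →₀ ℕ) :
    (monomial (e.filter fun i => i ≠ a ∧ i ≠ b ∧ i ≠ c ∧ i ≠ d) (1 : R) : MvPolynomial (Fin n) R)
      ∈ A := by
  classical
  rw [monomial_eq, C_1, one_mul, Finsupp.prod]
  refine A.prod_mem fun i hi => A.pow_mem ?_ _
  rw [Finsupp.mem_support_iff, Finsupp.filter_apply] at hi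
  split_ifs at hi with h
  · exact hpass i h.1 h.2.1 h.2.2.1 h.2.2.2
  · exact absurd rfl hi

include h40 h31 h22 h13 h04 h201 h111 h021 h002 h1001 h0101 h0012 h0004 in
/-- **`¼(1,1,2,3)` in «any subalgebra» form**: a monomial `x^e` with `4 ∣ e a + e b + 2 e c + 3 e d`
lies in every subalgebra of `R[x₁,…,xₙ]` containing the thirteen cone monomials and the passengers
`X i` (`i ∉ {a,b,c,d}`). [OURS · W4.5c] -/
theorem monomial_mem_of_four_dvd (hab : a ≠ b) (hac : a ≠ c) (had : a ≠ d) (hbc : b ≠ c)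
    (hbd : b ≠ d) (hcd : c ≠ d) (hpass : ∀ i, i ≠ a → i ≠ b → i ≠ c → i ≠ d → X i ∈ A)
    (e : Fin n →₀ ℕ) (he : 4 ∣ e a + e b + 2 * e c + 3 * e d) :
    (monomial e (1 : R) : MvPolynomial (Fin n) R) ∈ A := by
  rw [monomial_eq_abcd_mul_passengers hab hac had hbc hbd hcd e]
  exact A.mul_mem (prod_pow_mem_of_four_dvd h40 h31 h22 h13 h04 h201 h111 h021 h002 h1001 h0101
    h0012 h0004 _ _ _ _ he) (monomial_passengers_mem hpass e)

end AnySubalgebra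

section Weight

variable {n : ℕ} {a b c d : Fin n} (w : Fin n → ZMod 4) (hwa : w a = 1) (hwb : w b = 1)
  (hwc : w c = 2) (hwd : w d = 3) (hw0 : ∀ i, i ≠ a → i ≠ b → i ≠ c → i ≠ d → w i = 0)

include hwa hwb hwc hwd hw0 in
/-- **The `μ₄`-weight of an exponent vector** is `e a + e b + 2 e c + 3 e d (mod 4)` for the weight
`(a,b,c,d) ↦ (1,1,2,3)`, passengers `↦ 0`. [OURS · W4.5c] -/
theorem weight_eq_natCast (hab : a ≠ b) (hac : a ≠ c) (had : a ≠ d) (hbc : b ≠ c) (hbd : b ≠ d)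
    (hcd : c ≠ d) (e : Fin n →₀ ℕ) :
    Finsupp.weight w e = ((e a + e b + 2 * e c + 3 * e d : ℕ) : ZMod 4) := by
  classical
  have hpass : Finsupp.weight w (e.filter fun i => i ≠ a ∧ i ≠ b ∧ i ≠ c ∧ i ≠ d) = 0 := by
    rw [Finsupp.weight_apply, Finsupp.sum]
    refine Finset.sum_eq_zero fun i hi => ?_
    rw [Finsupp.mem_support_iff, Finsupp.filter_apply] at hi
    split_ifs at hi with h
    · rw [hw0 i h.1 h.2.1 h.2.2.1 h.2.2.2, smul_zero]
    · exact absurd rfl hi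
  conv_lhs => rw [eq_singles_add_filter hab hac had hbc hbd hcd e]
  rw [map_add, map_add, map_add, map_add, hpass, add_zero, Finsupp.weight_single,
    Finsupp.weight_single, Finsupp.weight_single, Finsupp.weight_single, hwa, hwb, hwc, hwd]
  simp only [nsmul_eq_mul, Nat.cast_add, Nat.cast_mul, Nat.cast_ofNat, mul_one]
  ring

include hwa hwb hwc hwd hw0 in
/-- `Finsupp.weight w e = 0 ↔ 4 ∣ e a + e b + 2 e c + 3 e d`. [OURS · W4.5c] -/
theorem weight_eq_zero_iff (hab : a ≠ b) (hac : a ≠ c) (had : a ≠ d) (hbc : b ≠ c) (hbd : b ≠ d)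
    (hcd : c ≠ d) (e : Fin n →₀ ℕ) :
    Finsupp.weight w e = 0 ↔ 4 ∣ e a + e b + 2 * e c + 3 * e d := by
  rw [weight_eq_natCast w hwa hwb hwc hwd hw0 hab hac had hbc hbd hcd, ZMod.natCast_eq_zero_iff]

end Weight

section Adjoin

variable {R : Type*} [CommRing R] {n : ℕ} {a b c d : Fin n}
  (w : Fin n → ZMod 4) (hwa : w a = 1) (hwb : w b = 1) (hwc : w c = 2) (hwd : w d = 3)
  (hw0 : ∀ i, i ≠ a → i ≠ b → i ≠ c → i ≠ d → w i = 0)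

include hwa hwb hwc hwd hw0 in
/-- **The weight-`0` part is generated by the thirteen `¼(1,1,2,3)` monomials and the passengers**:
for any set `G` of weight-`0` polynomials whose generated subalgebra contains
`s⁴, s³t, s²t², st³, t⁴, s²u, stu, t²u, u², sv, tv, uv², v⁴` (`s,t,u,v = X a, X b, X c, X d`) and
the passenger variables, `f ∈ Algebra.adjoin R G ↔ IsWeightedHomogeneous w f 0`.
[OURS · W4.5c] -/
theorem mem_adjoin_iff_isWeightedHomogeneous_zero (hab : a ≠ b) (hac : a ≠ c) (had : a ≠ d)
    (hbc : b ≠ c) (hbd : b ≠ d) (hcd : c ≠ d) (G : Set (MvPolynomial (Fin n) R))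
    (hG : ∀ g ∈ G, IsWeightedHomogeneous w g 0)
    (h40 : (X a ^ 4 : MvPolynomial (Fin n) R) ∈ Algebra.adjoin R G)
    (h31 : (X a ^ 3 * X b : MvPolynomial (Fin n) R) ∈ Algebra.adjoin R G)
    (h22 : (X a ^ 2 * X b ^ 2 : MvPolynomial (Fin n) R) ∈ Algebra.adjoin R G)
    (h13 : (X a * X b ^ 3 : MvPolynomial (Fin n) R) ∈ Algebra.adjoin R G)
    (h04 : (X b ^ 4 : MvPolynomial (Fin n) R) ∈ Algebra.adjoin R G)
    (h201 : (X a ^ 2 * X c : MvPolynomial (Fin n) R) ∈ Algebra.adjoin R G)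
    (h111 : (X a * X b * X c : MvPolynomial (Fin n) R) ∈ Algebra.adjoin R G)
    (h021 : (X b ^ 2 * X c : MvPolynomial (Fin n) R) ∈ Algebra.adjoin R G)
    (h002 : (X c ^ 2 : MvPolynomial (Fin n) R) ∈ Algebra.adjoin R G)
    (h1001 : (X a * X d : MvPolynomial (Fin n) R) ∈ Algebra.adjoin R G)
    (h0101 : (X b * X d : MvPolynomial (Fin n) R) ∈ Algebra.adjoin R G)
    (h0012 : (X c * X d ^ 2 : MvPolynomial (Fin n) R) ∈ Algebra.adjoin R G)
    (h0004 : (X d ^ 4 : MvPolynomial (Fin n) R) ∈ Algebra.adjoin R G)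
    (hpass : ∀ i, i ≠ a → i ≠ b → i ≠ c → i ≠ d → (X i : MvPolynomial (Fin n) R) ∈ Algebra.adjoin R G)
    (f : MvPolynomial (Fin n) R) :
    f ∈ Algebra.adjoin R G ↔ IsWeightedHomogeneous w f 0 :=
  ToricExit.mem_adjoin_iff_isWeightedHomogeneous_zero w G hG (fun e he =>
    monomial_mem_of_four_dvd h40 h31 h22 h13 h04 h201 h111 h021 h002 h1001 h0101 h0012 h0004
      hab hac had hbc hbd hcd hpass e
      ((weight_eq_zero_iff w hwa hwb hwc hwd hw0 hab hac had hbc hbd hcd e).mp he)) f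

end Adjoin

end Summit.ResolutionOfSingularities.ResolutionOfSingularities.Theorems.WildQuotientResolution.Quarter1123

end
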